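import Summits.CriticalPhenomena.PercolationContinuityZ3.Theorems.SahiMasterFamilyHSharp
import Summits.CriticalPhenomena.PercolationContinuityZ3.Theorems.SahiMasterFamilyPhiOrbit
import Summits.CriticalPhenomena.PercolationContinuityZ3.Theorems.SahiMasterFamilyPhiCapClosedForm

/-!
# H♯(8) and TH♯(8) are FALSE on the union-closed hull: the BI-GLUED mixture, checked in the kernel

Unit `prim-masterthm-p4` (gen 20; crux anchor stmt-CriticalPhenomena-4575, helper work; memo
`run/shared/lean/prim/prim-masterthm/prim-masterthm-p4/P4-GEN20-REPORT.md` §2).  Companion of `…SahiMasterFamilyHSharp` (gen 17: the typed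
conjectures `HSharp.HSharpNonneg k` = H♯(k): `Σ_t Φ_k(cap_t β) ≤ k·Φ_k(β)` at every mixture `β` of indicators of union-closed families `∋ univ`, and
its tuple version `HSharp.THSharpNonneg`, with `hSharpNonneg_of_thSharpNonneg`, `ucHullNonneg_of_hSharpNonneg`; kernel `k ≤ 3`, `…HSharpThree`).

**THEOREM (this file).** `not_hSharpNonneg_eight : ¬ HSharpNonneg 8` and `not_thSharpNonneg_eight : ¬ THSharpNonneg 8`.
WITNESS (found by gen 20's exhaustive scan of two-block-invariant pairs, exact): `T = B₁ ⊔ B₂`, `B₁ = {0,1,2,3}`, `B₂ = {4,5,6,7}`, the two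
union-closed families **`𝒢₁ = {S : S ∩ B₁ = ∅} ∪ {S ⊇ B₁} ∪ {S ⊇ B₂}`** ("glued along `B₁`, plus the supersets of `B₂`") and its mirror `𝒢₂`
(`B₁ ↔ B₂`), weights `½, ½`:  `Φ_8(β) = 438399/256 ≈ 1712.50 > 0` but `Φ_8(cap_t β) = 220455/128 ≈ 1722.30` for every `t`, so
**`8·Φ_8(β) − Σ_t Φ_8(cap_t β) = −2511/32 < 0`**.  The same two-family point violates H♯(k) for EVERY `k ≥ 8` tested (`k ≤ 40`, blocks `⌊k/2⌋|⌈k/2⌉`;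
`k·Φ/Σ_tΦ(cap_t)` = 0.994, 0.974, 0.950, …, 0.852 at k = 8, 9, 10, …, 40, exact rationals, memo §2), while `Φ` itself and the H♭ functional stay
positive there.  So, after SDH♭/SDH♭-LIN/BILIN (gen 19, `…SDHFlatEight`), the diagonal candidates H♯ and TH♯ also die at `k = 8`: of the typed all-`k`
vehicles only H♭ (`HFlat.HFlatNonneg`, kernel `k ≤ 5`), the quarter bound and (UC-hull)_k itself remain unrefuted.

METHOD (proof by reflection, `native_decide`; a COMPUTATIONAL file).  `phiSetQ` = the cycle form of `Φ` over `ℚ` (`PhiVertex.phiSet_eq_sum_perm`;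
the same three-line mirror as in the companion `…SDHFlatEight`, repeated here so that the two files are independent), `capLastQ` = the closed form
`Φ_{k+1}(cap_last β) = Σ_{σ ∈ S_k} ∏_c (1 − β_c)` over `ℚ` (`PhiCapClosedForm.phiSet_cap_eq_sum_perm`, a sum over `7! = 5040` permutations only), and
`phiSet_cap_eq_of_invariant` — all eight capped functionals coincide with the one at the last index because `β` is invariant under a
symmetry `sym t` moving `7` to `t` (symmetry of `Φ`, `PhiCert.phiSet_actV`).  HONEST FRAMING: two typed conjectures refuted at `k = 8` (H♯ is a theorem for `k ≤ 3`, numerically clean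
`k ≤ 7`); H♭ (k ≥ 6), (UC-hull)_k (k ≥ 8), Sahi's `C_k`, Kahn's Conjecture 5 and the master theorem remain OPEN.  Axioms standard + `Lean.ofReduceBool`.
[this work]
-/

namespace Summit.CriticalPhenomena.PercolationContinuityZ3.Theorems

namespace HSharpEight

open Finset
open Literature.Combinatorics.Sahi2008
open PrincipalCapBeta (phiSet)
open HSharp (HSharpNonneg THSharpNonneg)

variable {k : ℕ}

/-! ### Exact rational mirrors -/

/-- `Φ_{n+1}` over `ℚ` in cycle form: `Σ_σ (−1)^{#cycles − 1} ∏_{c ∈ cycles σ} q(c)` (as in `…SDHFlatEight`). [this work] -/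
def phiSetQ (n : ℕ) (q : Finset (Fin (n + 1)) → ℚ) : ℚ :=
  ∑ σ : Equiv.Perm (Fin (n + 1)), (-1 : ℚ) ^ ((CycleForm.orbits σ).card - 1) * ∏ B ∈ CycleForm.orbits σ, q B

/-- `Φ_{n+1}` at a rational point is the cast of `phiSetQ`. [this work] -/
theorem phiSet_eq_cast_phiSetQ (n : ℕ) (q : Finset (Fin (n + 1)) → ℚ) :
    phiSet (n + 1) (fun S => (q S : ℝ)) = ((phiSetQ n q : ℚ) : ℝ) := by
  rw [PhiVertex.phiSet_eq_sum_perm, phiSetQ]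
  push_cast
  rfl

/-- The capped functional at the last index over `ℚ`, in closed form: `Σ_{σ ∈ S_k} ∏_{c ∈ cycles σ} (1 − q(c))` (the permutation partition
function `W_{[k]}(1 − q)`). [this work] -/
def capLastQ (k : ℕ) (q : Finset (Fin (k + 1)) → ℚ) : ℚ :=
  ∑ σ : Equiv.Perm (Fin k), ∏ B ∈ CycleForm.orbits σ, (1 - q (B.map Fin.castSuccEmb))

/-- `Φ_{k+1}(cap_last q) = capLastQ k q` for `q univ = 1` (`PhiCapClosedForm.phiSet_cap_eq_sum_perm`). [this work] -/
theorem phiSet_capLast_eq_cast (q : Finset (Fin (k + 1)) → ℚ) (huniv : q univ = 1) :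
    phiSet (k + 1) (fun B => if Fin.last k ∈ B then 1 else (q B : ℝ)) = ((capLastQ k q : ℚ) : ℝ) := by
  have h1 : (fun B : Finset (Fin (k + 1)) => (q B : ℝ)) univ = 1 := by simp [huniv]
  rw [PhiCapClosedForm.phiSet_cap_eq_sum_perm (fun B => (q B : ℝ)) h1, capLastQ]
  push_cast
  rfl

/-- **Caps transform under a symmetry of `β`**: if `β(σ(S)) = β(S)` for every `S`, then `Φ(cap_t β) = Φ(cap_{σ⁻¹ t} β)`
(symmetry of `Φ`, `PhiCert.phiSet_actV`). [this work] -/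
theorem phiSet_cap_eq_of_invariant (β : Finset (Fin (k + 1)) → ℝ) (σ : Equiv.Perm (Fin (k + 1))) (t : Fin (k + 1))
    (hinv : ∀ S, β (S.map σ.toEmbedding) = β S) :
    phiSet (k + 1) (fun S => if t ∈ S then 1 else β S) = phiSet (k + 1) (fun S => if σ.symm t ∈ S then 1 else β S) := by
  rw [← PhiCert.phiSet_actV σ (fun S => if t ∈ S then 1 else β S)]
  congr 1
  funext S
  unfold PhiCert.actV
  simp only [Finset.mem_map_equiv, hinv S]

/-! ### The witness at `k = 8` -/

/-- The first block `B₁ = {0,1,2,3}`. [this work] -/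
def blk1 : Finset (Fin 8) := {0, 1, 2, 3}

/-- The second block `B₂ = {4,5,6,7}`. [this work] -/
def blk2 : Finset (Fin 8) := {4, 5, 6, 7}

/-- The glued family `{S : S ∩ b = ∅} ∪ {S ⊇ b} ∪ {S ⊇ b'}`. [this work] -/
def glue (b b' : Finset (Fin 8)) : Finset (Finset (Fin 8)) :=
  univ.filter fun S => S ∩ b = ∅ ∨ b ⊆ S ∨ b' ⊆ S

/-- The two families of the bi-glued mixture: `𝒢₁ = glue B₁ B₂`, `𝒢₂ = glue B₂ B₁`. [this work] -/
def famV : Fin 2 → Finset (Finset (Fin 8)) := ![glue blk1 blk2, glue blk2 blk1]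

/-- The bi-glued point `β = ½·1_{𝒢₁} + ½·1_{𝒢₂}` over `ℚ`. [this work] -/
def qγ : Finset (Fin 8) → ℚ := fun S =>
  (1 / 2 : ℚ) * (if S ∈ glue blk1 blk2 then 1 else 0) + (1 / 2 : ℚ) * (if S ∈ glue blk2 blk1 then 1 else 0)

/-- The two glued families are closed under unions. [this work] -/
theorem famV_unionClosed : ∀ x : Fin 2, ∀ A ∈ famV x, ∀ A' ∈ famV x, A ∪ A' ∈ famV x := by
  native_decide

/-- The two glued families contain `univ`. [this work] -/
theorem famV_top : ∀ x : Fin 2, (univ : Finset (Fin 8)) ∈ famV x := by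
  native_decide

/-- `β univ = 1`. [this work] -/
theorem qγ_univ : qγ univ = 1 := by
  native_decide

/-- A symmetry of the bi-glued configuration moving `7` to `t`: a transposition inside `B₂` for `t ∈ B₂`, the block exchange
`i ↦ i + 4` followed by a transposition inside `B₁` for `t ∈ B₁`. [this work] -/
def sym (t : Fin 8) : Equiv.Perm (Fin 8) :=
  if t ∈ blk2 then Equiv.swap t (Fin.last 7) else Equiv.swap 3 t * Equiv.addRight (4 : Fin 8)

/-- `sym t` maps `7` to `t` (equivalently `(sym t)⁻¹ t = 7`). [this work] -/
theorem sym_symm_apply : ∀ t : Fin 8, (sym t).symm t = Fin.last 7 := by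
  native_decide

/-- `β` is invariant under each `sym t` (indeed under the whole group `S_4 ≀ S_2` of the two blocks). [this work] -/
theorem qγ_sym : ∀ t : Fin 8, ∀ S : Finset (Fin 8), qγ (S.map (sym t).toEmbedding) = qγ S := by
  native_decide

/-- **`Φ_8(β) = 438399/256`** (exact, `native_decide` over the `8!` permutations). [this work] -/
theorem phiSetQ_qγ : phiSetQ 7 qγ = 438399 / 256 := by
  native_decide

/-- **`Φ_8(cap_7 β) = 220455/128`** (exact, `native_decide` over the `7!` permutations). [this work] -/
theorem capLastQ_qγ : capLastQ 7 qγ = 220455 / 128 := by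
  native_decide

/-- The mixture with weights `½, ½` of the indicators of `famV`, pointwise, is (the cast of) `qγ`. [this work] -/
theorem mixture_eq_qγ (S : Finset (Fin 8)) :
    (∑ x : Fin 2, (1 / 2 : ℝ) * (if S ∈ famV x then (1 : ℝ) else 0)) = ((qγ S : ℚ) : ℝ) := by
  simp only [Fin.sum_univ_two, famV, qγ, Matrix.cons_val_zero, Matrix.cons_val_one]
  push_cast
  split_ifs <;> norm_num

/-- Every capped functional of `β` equals `220455/128`. [this work] -/
theorem phiSet_cap_qγ (t : Fin 8) :
    phiSet 8 (fun S => if t ∈ S then 1 else ((qγ S : ℚ) : ℝ)) = ((220455 / 128 : ℚ) : ℝ) := by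
  have hinv : ∀ S : Finset (Fin 8), (fun S => ((qγ S : ℚ) : ℝ)) (S.map (sym t).toEmbedding) = ((qγ S : ℚ) : ℝ) :=
    fun S => by simp only [qγ_sym t S]
  rw [phiSet_cap_eq_of_invariant (fun S => ((qγ S : ℚ) : ℝ)) (sym t) t hinv, sym_symm_apply t,
    phiSet_capLast_eq_cast qγ qγ_univ, capLastQ_qγ]

/-- **H♯(8) is false.** [this work] -/
theorem not_hSharpNonneg_eight : ¬ HSharpNonneg 8 := by
  intro h
  have h0 := h (Fin 2) (fun _ => (1 / 2 : ℝ)) famV (fun _ => by norm_num) (by norm_num [Fin.sum_univ_two])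
    famV_unionClosed famV_top
  simp only [mixture_eq_qγ, phiSet_cap_qγ, sum_const, card_univ, Fintype.card_fin, nsmul_eq_mul] at h0
  rw [phiSet_eq_cast_phiSetQ, phiSetQ_qγ] at h0
  norm_num at h0

/-- **TH♯(8) is false** (it implies H♯(8)). [this work] -/
theorem not_thSharpNonneg_eight : ¬ THSharpNonneg 8 := fun h =>
  not_hSharpNonneg_eight (HSharp.hSharpNonneg_of_thSharpNonneg h)

end HSharpEight

end Summit.CriticalPhenomena.PercolationContinuityZ3.Theorems
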